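import Summits.BirchSwinnertonDyer.BirchSwinnertonDyer.Theorems.Rank2ObservatoryCubicFieldM5011
import Summits.BirchSwinnertonDyer.BirchSwinnertonDyer.Theorems.Rank2ObservatoryCubicFieldM5011GensR3a
import Summits.BirchSwinnertonDyer.BirchSwinnertonDyer.Theorems.Rank2Observatory2DescLinGens
import HarnessLib

/-!
# BirchSwinnertonDyer — rank ≥ 2 observatory: prime elements of the cubic field of `-6 + 11 * X - X ^ 2 + X ^ 3` (generator addendum `M5011 C1a`)

HONEST FRAMING: per-curve certified theorems and census instruments; no claim on BSD in rank ≥ 2.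

Per-FIELD addendum of the KERNEL-2DESC instrument (design `b2b-bsdr2-cert-3/KERNEL-2DESC.md` §9d) for the cubic
field `K = ℚ(α)`, `α` a root of `-6 + 11 * X - X ^ 2 + X ^ 3` (`Δ = -5011`, `𝓞_K` a PID; file `Rank2ObservatoryCubicFieldM5011`):
for 3 elements `e = c₀ + c₁α + c₂α² = lin aeval_α c₀ c₁ c₂` it certifies the norm (`MonicCubic.normForm`,
`norm_lin_eq`), primality (norm `±p`, or norm `±p^f` with the residue certificate of `lin_prime_of_pow`) and
the sign at the real place (`557/1000 < ρ(α) < 279/500`, `lin_pos` / `lin_neg`). These elements generate the primes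
dividing `F′(θ)` for the census curves with this `2`-division field, `N < 5·10⁵` (data: kit job `j130050` + second
implementation `percurve/identities3.py`); the per-curve files `Rank2Observatory<label>TwoDescRankTwo.lean`
reference them by name (`e_<c₀>_<c₁>_<c₂>_norm|prime|pos|neg`, `m` = minus). Generated by
`percurve/gen_addendum4.py`. Sorry-free; axioms `propext`, `Classical.choice`, `Quot.sound`.
[cite: Marcus2018, Ch. 3, Thm. 22] [cite: Cassels1991LecturesEllipticCurves, §15]
Elements already certified in the same namespace by the rank-3 port addenda (`Rank2ObservatoryCubicFieldM5011GensR3a`, unit `b2b-bsdr2-cert-2`) are imported from there and not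
re-declared here (6 lemma(s) omitted, 3 kept).
-/

-- single-conjunct summit: `Summit.BirchSwinnertonDyer.BirchSwinnertonDyer.…` repeats the name by design
set_option linter.dupNamespace false

noncomputable section

open scoped NumberField

open Literature.NumberTheory.NumberFields Polynomial NumberField

namespace Summit.BirchSwinnertonDyer.BirchSwinnertonDyer.Rank2Observatory.TwoDescCubic.FieldM5011

/-- `N(-1484 + 61 * α - 138 * α ^ 2) = -2` (a prime above `2`, residue degree `1`; first met at `320704i1`). [folklore] -/
theorem e_m1484_61_m138_norm : Algebra.norm ℚ ((lin aeval_α (-1484) 61 (-138) : 𝓞 (CubicField (-1) 11 (-6))) : (CubicField (-1) 11 (-6))) = ((-2 : ℤ) : ℚ) :=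
  norm_lin_eq irreducible aeval_α finrank_eq (-1484) 61 (-138) (by norm_num [MonicCubic.normForm])

/-- `-1484 + 61 * α - 138 * α ^ 2` is prime (norm `±2`). [cite: Marcus2018, Ch. 3, Thm. 22] -/
theorem e_m1484_61_m138_prime : Prime (lin aeval_α (-1484) 61 (-138) : 𝓞 (CubicField (-1) 11 (-6))) :=
  lin_prime_of_prime irreducible aeval_α finrank_eq (-1484) 61 (-138) (n := -2)
    (by norm_num [MonicCubic.normForm]) (by norm_num)

/-- `ρ(-1484 + 61 * α - 138 * α ^ 2) < 0` at the real place. [folklore] -/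
theorem e_m1484_61_m138_neg (ρ : (CubicField (-1) 11 (-6)) →+* ℝ) (hlo : ((557/1000 : ℚ) : ℝ) < ρ (CubicField.root (-1) 11 (-6))) (hhi : ρ (CubicField.root (-1) 11 (-6)) < ((279/500 : ℚ) : ℝ)) :
    ρ ((lin aeval_α (-1484) 61 (-138) : 𝓞 (CubicField (-1) 11 (-6))) : (CubicField (-1) 11 (-6))) < 0 :=
  lin_neg aeval_α ρ (by norm_num) hlo hhi (-1484) 61 (-138) (by norm_num)

end Summit.BirchSwinnertonDyer.BirchSwinnertonDyer.Rank2Observatory.TwoDescCubic.FieldM5011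

end
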